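import Summits.Schanuel.Schanuel.Theses.TateNomes
import Literature.Barriers.Schanuel.NesterenkoModularScopeHolds
import Literature.Barriers.Schanuel.LargeTranscendenceDegree
import Literature.Barriers.Schanuel.AlgebraicIndependenceOfLogarithms
import Literature.NumberTheory.Transcendental.RankOneGridTrdeg
import Literature.NumberTheory.Transcendental.LindemannWeierstrassProofs
import HarnessLib

/-!
# Crux-strategist (gen r1, RESTATED re-exam) — typed decompositions of `TateLocusGPC`
# (stmt-Schanuel-17404, route `TateNomes`) for the BC2-REDIRECT test (a)–(d)

NOT a line, NOT registered.  Every candidate decomposition `X₁ ∧ … ∧ X_k → TateLocusGPC` examined in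
`STRATEGY-CENSUS.md` v3 §R is typed here with its assembly PROVED (criterion (b)); the census records,
per candidate, which of (c) [a piece gives the crux / the summit on its own] or (d) [an open piece has no
plan] fails, or that a piece is FALSE as typed.  Pieces (this namespace):

* bridge (Wiles-shape) splits: `TateEllipticGPC ∧ TateToricBridge` (D-1), `MultiNomeNesterenko ∧ TauPiBridge`
  (D-11), `TateLocusGPCOne ∧ OneToMany` (D-12), `CruxAt 3 ∧ ThreeToAll` (D-13), `(∀ m ≤ 3, CruxAt m) ∧ Steps` (D-13′), `Schanuel ∧ SchanuelToCrux`
  (D-10), `nesterenko1996_thm_1_1 ∧ NestBridge` (D-14, a PROVED antecedent: (c) fails mechanically,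
  `nestBridge_alone`);
* additive (fixed-budget) splits: `TateSchanuel ∧ RelModularFixed` (D-2), `MultiNomeNesterenko ∧
  TauPiAdjunctionFixed` (D-3′) — assemblies proved, second pieces FALSE on paper (census);
* partitions: sectors `SectorAlgLog ∧ SectorAlgMod ∧ SectorGeneric` (D-5/D-8), ranges of `m`
  `CruxSmall M₀ ∧ CruxLarge M₀` (D-6);
* conclusion slicing `CruxWeak ∧ NoLevel` (D-15).

KERNEL-CHECKED (c)-FAILURES (census §R.1, Lemma A — the appending principle — is a THEOREM here, axioms
`propext, Classical.choice, Quot.sound` only): `tateCompletion_holds` (every Tate tuple extends by one ALGEBRAIC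
logarithm `−2^{(k+1)/p}` to a Tate tuple; uses only `π ∉ ℚ̄`), `trdeg_env_snoc_le` (the appended block costs ≤ 4),
hence `cruxMono : ∀ m, CruxAt (m+1) → CruxAt m`, `cruxLarge_iff : CruxLarge M₀ ↔ TateLocusGPC` (every M₀) and
`sectorAlgLog_iff : SectorAlgLog ↔ TateLocusGPC` — the range piece and the "some algebraic logarithm" sector piece
are the crux PADDED, not thin pieces; and `nestBridge_iff : NestBridge ↔ TateLocusGPC` (D-14).
KERNEL-CHECKED FALSITY of a fixed-budget piece: `tate_wLW` (the Lindemann–Weierstrass triple `(−1, −√2, 2πi − 1 − √2)`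
IS in Tate position — non-vacuity of the crux hypotheses at `m = 3`, `tatePosition_satisfiable_three`) and
`not_tauPiAdjunctionFixed : ¬ TauPiAdjunctionFixed` (on that triple the logarithms add ≤ 1 < 3 to `ℚ(e^w,P,Q,R)`), so the
route's two-layer plan "MNN → TauPiAdjunction" is sound only in bridge form (D-11).
-/

noncomputable section

-- single-conjunct summit: `Summit.Schanuel.Schanuel.…` repeats the name by the D-0017 layout
set_option linter.dupNamespace false

namespace Summit.Schanuel.Schanuel.Cruxes.TateLocusGPC.StrategistR1

open Summit.Schanuel.Schanuel.Theses.TateNomes (TateLocusGPC TateLocusGPCOne MultiNomeNesterenko)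

/-! ## Spelling (as in StrategistSketchG1) -/

/-- Ramanujan's `P = E₂` as the route's inline `q`-series. -/
def ramP (q : ℂ) : ℂ := 1 - 24 * ∑' l : ℕ, (ArithmeticFunction.sigma 1 (l + 1) : ℂ) * q ^ (l + 1)

/-- Ramanujan's `Q = E₄` as the route's inline `q`-series. -/
def ramQ (q : ℂ) : ℂ := 1 + 240 * ∑' l : ℕ, (ArithmeticFunction.sigma 3 (l + 1) : ℂ) * q ^ (l + 1)

/-- Ramanujan's `R = E₆` as the route's inline `q`-series. -/
def ramR (q : ℂ) : ℂ := 1 - 504 * ∑' l : ℕ, (ArithmeticFunction.sigma 5 (l + 1) : ℂ) * q ^ (l + 1)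

/-- `J(q) = 1728 Q³/(Q³ − R²)` (`= j(τ)` at `q = e^{2πiτ}`). -/
def jOfNome (q : ℂ) : ℂ := 1728 * ramQ q ^ 3 / (ramQ q ^ 3 - ramR q ^ 2)

/-- `τ = w / 2πi`. -/
def tauOf (w : ℂ) : ℂ := w / (2 * (Real.pi : ℂ) * Complex.I)

/-- The five hypotheses of the crux ("Tate position"), verbatim. -/
def TatePosition (m : ℕ) (w : Fin m → ℂ) : Prop :=
  LinearIndependent ℚ w ∧
  (2 * (Real.pi : ℂ) * Complex.I) ∈ Submodule.span ℚ (Set.range w) ∧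
  (∀ j, (w j).re < 0) ∧
  (∀ j, ∀ b c : ℚ, tauOf (w j) ^ 2 + (b : ℂ) * tauOf (w j) + (c : ℂ) ≠ 0) ∧
  (∀ i j, i ≠ j → ∀ a b c d : ℚ, 0 < a * d - b * c →
    tauOf (w j) * ((c : ℂ) * tauOf (w i) + (d : ℂ)) ≠ (a : ℂ) * tauOf (w i) + (b : ℂ))

/-- The envelope `Env(w) = ℚ(w, e^w, P, Q, R)`. -/
def Env (m : ℕ) (w : Fin m → ℂ) : IntermediateField ℚ ℂ :=
  IntermediateField.adjoin ℚ (Set.range w ∪ Set.range (Complex.exp ∘ w) ∪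
    Set.range (fun j => ramP (Complex.exp (w j))) ∪ Set.range (fun j => ramQ (Complex.exp (w j))) ∪
    Set.range (fun j => ramR (Complex.exp (w j))))

/-- The exponential-free sub-envelope `ℚ(w, P, Q, R)` (pure periods). -/
def EnvPure (m : ℕ) (w : Fin m → ℂ) : IntermediateField ℚ ℂ :=
  IntermediateField.adjoin ℚ (Set.range w ∪
    Set.range (fun j => ramP (Complex.exp (w j))) ∪ Set.range (fun j => ramQ (Complex.exp (w j))) ∪
    Set.range (fun j => ramR (Complex.exp (w j))))

/-- The logarithm-free sub-envelope `ℚ(e^w, P, Q, R)` (the field of `MultiNomeNesterenko`). -/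
def EnvMod (m : ℕ) (w : Fin m → ℂ) : IntermediateField ℚ ℂ :=
  IntermediateField.adjoin ℚ (Set.range (Complex.exp ∘ w) ∪
    Set.range (fun j => ramP (Complex.exp (w j))) ∪ Set.range (fun j => ramQ (Complex.exp (w j))) ∪
    Set.range (fun j => ramR (Complex.exp (w j))))

/-- The Schanuel field `ℚ(w, e^w)` of the tuple. -/
def EnvExp (m : ℕ) (w : Fin m → ℂ) : IntermediateField ℚ ℂ :=
  IntermediateField.adjoin ℚ (Set.range w ∪ Set.range (Complex.exp ∘ w))

/-- The crux at a fixed number of nomes `m`. -/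
def CruxAt (m : ℕ) : Prop :=
  ∀ w : Fin m → ℂ, TatePosition m w → ((4 * m : ℕ) : Cardinal) ≤ Algebra.trdeg ℚ ↥(Env m w)

/-- The route decl is `∀ m, CruxAt m` (curried ↔ uncurried hypotheses; the fields agree by `rfl`). -/
theorem crux_iff : TateLocusGPC ↔ ∀ m, CruxAt m := by
  constructor
  · intro h m w hw
    exact h m w hw.1 hw.2.1 hw.2.2.1 hw.2.2.2.1 hw.2.2.2.2
  · intro h m w h1 h2 h3 h4 h5
    exact h m w ⟨h1, h2, h3, h4, h5⟩

/-- `MultiNomeNesterenko` (route decl) in the sketch's spelling. -/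
theorem mnn_iff : MultiNomeNesterenko ↔
    ∀ (m : ℕ) (w : Fin m → ℂ), TatePosition m w → ((3 * m : ℕ) : Cardinal) ≤ Algebra.trdeg ℚ ↥(EnvMod m w) := by
  constructor
  · intro h m w hw
    exact h m w hw.1 hw.2.1 hw.2.2.1 hw.2.2.2.1 hw.2.2.2.2
  · intro h m w h1 h2 h3 h4 h5
    exact h m w ⟨h1, h2, h3, h4, h5⟩

/-! ## D-1  pure-motive GPC ∧ toric bridge (Wiles shape) -/

/-- **TateEllipticGPC**: GPC for `⊕ⱼ h¹(E_{τⱼ})` on the Tate locus, `3m + 1 ≤ trdeg ℚ(w, P, Q, R)`. OPEN. -/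
def TateEllipticGPC : Prop :=
  ∀ (m : ℕ) (w : Fin m → ℂ), TatePosition m w → ((3 * m + 1 : ℕ) : Cardinal) ≤ Algebra.trdeg ℚ ↥(EnvPure m w)

/-- **TateToricBridge**: pure bound `3m+1` ⇒ full bound `4m` (adaptive budget, bridge form). OPEN. -/
def TateToricBridge : Prop :=
  ∀ (m : ℕ) (w : Fin m → ℂ), TatePosition m w →
    ((3 * m + 1 : ℕ) : Cardinal) ≤ Algebra.trdeg ℚ ↥(EnvPure m w) →
      ((4 * m : ℕ) : Cardinal) ≤ Algebra.trdeg ℚ ↥(Env m w)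

/-- (b) for D-1: two lines. -/
theorem d1_assembly (hE : TateEllipticGPC) (hB : TateToricBridge) : TateLocusGPC :=
  crux_iff.2 fun m w hw => hB m w hw (hE m w hw)

/-! ## D-11  modular half ∧ (τ, 2πi)-adjunction bridge;  D-3′ its fixed-budget form -/

/-- **TauPiBridge**: `MultiNomeNesterenko → TateLocusGPC` ("relative Schanuel for `(2πi, τ)` over the
modular–exponential field", adaptive budget). OPEN. -/
def TauPiBridge : Prop := MultiNomeNesterenko → TateLocusGPC

/-- (b) for D-11: modus ponens (`trivial_seam`). -/
theorem d11_assembly (hM : MultiNomeNesterenko) (hB : TauPiBridge) : TateLocusGPC := hB hM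

/-- **TauPiAdjunctionFixed**: adjoining `w = 2πiτ` to `ℚ(e^w, P, Q, R)` raises the transcendence degree
by the full `m` (fixed budget).  FALSE on the Lindemann–Weierstrass sector (`w₁, …, w_{m−1} ∈ ℚ̄`), census §R. -/
def TauPiAdjunctionFixed : Prop :=
  ∀ (m : ℕ) (w : Fin m → ℂ), TatePosition m w →
    Algebra.trdeg ℚ ↥(EnvMod m w) + (m : Cardinal) ≤ Algebra.trdeg ℚ ↥(Env m w)

/-- (b) for D-3′: `4m = 3m + m`. -/
theorem d3'_assembly (hM : MultiNomeNesterenko) (hA : TauPiAdjunctionFixed) : TateLocusGPC := by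
  refine crux_iff.2 fun m w hw => ?_
  have h1 := mnn_iff.1 hM m w hw
  have h2 := hA m w hw
  have hcast : ((4 * m : ℕ) : Cardinal) = ((3 * m : ℕ) : Cardinal) + (m : Cardinal) := by
    push_cast; ring
  rw [hcast]
  exact (add_le_add h1 le_rfl).trans h2

/-! ## D-2  Schanuel on Tate tuples ∧ fixed relative modular bound -/

/-- **TateSchanuel**: Schanuel's conjecture for tuples in Tate position (a CONSEQUENCE of the summit). -/
def TateSchanuel : Prop :=
  ∀ (m : ℕ) (w : Fin m → ℂ), TatePosition m w → (m : Cardinal) ≤ Algebra.trdeg ℚ ↥(EnvExp m w)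

/-- **RelModularFixed**: the `3m` modular values are algebraically independent over `ℚ(w, e^w)` (fixed
budget).  FALSE at any Tate tuple with an algebraic modulus `j(τⱼ) ∈ ℚ̄` (then `Rⱼ` is algebraic over
`ℚ(Qⱼ)`), census §R. -/
def RelModularFixed : Prop :=
  ∀ (m : ℕ) (w : Fin m → ℂ), TatePosition m w →
    Algebra.trdeg ℚ ↥(EnvExp m w) + ((3 * m : ℕ) : Cardinal) ≤ Algebra.trdeg ℚ ↥(Env m w)

/-- (b) for D-2: `4m = m + 3m`. -/
theorem d2_assembly (hS : TateSchanuel) (hR : RelModularFixed) : TateLocusGPC := by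
  refine crux_iff.2 fun m w hw => ?_
  have h1 := hS m w hw
  have h2 := hR m w hw
  have hcast : ((4 * m : ℕ) : Cardinal) = (m : Cardinal) + ((3 * m : ℕ) : Cardinal) := by
    push_cast; ring
  rw [hcast]
  exact (add_le_add h1 le_rfl).trans h2

/-! ## D-12  one nome ∧ one-to-many bridge;  D-13  three nomes ∧ three-to-all bridge -/

/-- **OneToMany**: `TateLocusGPCOne → TateLocusGPC`. OPEN (the whole several-nome interaction). -/
def OneToMany : Prop := TateLocusGPCOne → TateLocusGPC

/-- (b) for D-12: modus ponens (`trivial_seam`). -/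
theorem d12_assembly (h1 : TateLocusGPCOne) (h2 : OneToMany) : TateLocusGPC := h2 h1

/-- **ThreeToAll**: the crux at `m = 3` implies it at every `m`. OPEN (upward induction has no true
fixed-budget increment lemma, census §R D-13). -/
def ThreeToAll : Prop := CruxAt 3 → TateLocusGPC

/-- (b) for D-13: modus ponens (`trivial_seam`). -/
theorem d13_assembly (h1 : CruxAt 3) (h2 : ThreeToAll) : TateLocusGPC := h2 h1

/-! ## D-10  the summit itself as antecedent;  D-14  a THEOREM as antecedent -/

/-- **SchanuelToCrux**: `Schanuel → TateLocusGPC` ("GPC on the Tate locus relative to Schanuel"). OPEN;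
the split fails (c) because its other piece IS the summit. -/
def SchanuelToCrux : Prop := _root_.Schanuel → TateLocusGPC

/-- (b) for D-10. -/
theorem d10_assembly (h1 : _root_.Schanuel) (h2 : SchanuelToCrux) : TateLocusGPC := h2 h1

/-- **NestBridge**: Nesterenko's Theorem 1.1 (a THEOREM of the tree) `→ TateLocusGPC`. -/
def NestBridge : Prop := Literature.Barriers.Schanuel.nesterenko1996_thm_1_1 → TateLocusGPC

/-- (b) for D-14. -/
theorem d14_assembly (h1 : Literature.Barriers.Schanuel.nesterenko1996_thm_1_1) (h2 : NestBridge) :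
    TateLocusGPC := h2 h1

/-- (c) FAILS for D-14: a bridge from a PROVED antecedent is the crux again (one piece gives `X` alone). -/
theorem nestBridge_alone (h : NestBridge) : TateLocusGPC :=
  h Literature.Barriers.Schanuel.nesterenko1996_thm_1_1_holds

/-- … and conversely, so `NestBridge ↔ TateLocusGPC`. -/
theorem nestBridge_iff : NestBridge ↔ TateLocusGPC :=
  ⟨nestBridge_alone, fun h _ => h⟩

/-! ## D-5 / D-8  sector partition by coincidence type -/

/-- Crux on the sector "some logarithm `wⱼ` is algebraic" (contains the Lindemann–Weierstrass sector). -/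
def SectorAlgLog : Prop :=
  ∀ (m : ℕ) (w : Fin m → ℂ), TatePosition m w → (∃ j, IsAlgebraic ℚ (w j)) →
    ((4 * m : ℕ) : Cardinal) ≤ Algebra.trdeg ℚ ↥(Env m w)

/-- Crux on the sector "some modulus `j(τⱼ)` is algebraic" (contains GPC for non-CM `ℚ̄`-curves). -/
def SectorAlgMod : Prop :=
  ∀ (m : ℕ) (w : Fin m → ℂ), TatePosition m w → (∃ j, IsAlgebraic ℚ (jOfNome (Complex.exp (w j)))) →
    ((4 * m : ℕ) : Cardinal) ≤ Algebra.trdeg ℚ ↥(Env m w)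

/-- Crux on the generic sector (no algebraic logarithm, no algebraic modulus): the crux minus thin sets. -/
def SectorGeneric : Prop :=
  ∀ (m : ℕ) (w : Fin m → ℂ), TatePosition m w → (∀ j, Transcendental ℚ (w j)) →
    (∀ j, Transcendental ℚ (jOfNome (Complex.exp (w j)))) →
    ((4 * m : ℕ) : Cardinal) ≤ Algebra.trdeg ℚ ↥(Env m w)

/-- (b) for D-5: case split (classical). -/
theorem d5_assembly (hL : SectorAlgLog) (hM : SectorAlgMod) (hG : SectorGeneric) : TateLocusGPC := by
  refine crux_iff.2 fun m w hw => ?_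
  by_cases h1 : ∃ j, IsAlgebraic ℚ (w j)
  · exact hL m w hw h1
  by_cases h2 : ∃ j, IsAlgebraic ℚ (jOfNome (Complex.exp (w j)))
  · exact hM m w hw h2
  push Not at h1 h2
  exact hG m w hw (fun j => h1 j) (fun j => h2 j)

/-! ## D-6  partition by ranges of `m`, and the monotonicity that defeats it -/

/-- Crux for `m < M₀`. -/
def CruxSmall (M₀ : ℕ) : Prop := ∀ m, m < M₀ → CruxAt m

/-- Crux for `m ≥ M₀` (the tail). -/
def CruxLarge (M₀ : ℕ) : Prop := ∀ m, M₀ ≤ m → CruxAt m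

/-- (b) for D-6. -/
theorem d6_assembly (M₀ : ℕ) (hS : CruxSmall M₀) (hL : CruxLarge M₀) : TateLocusGPC :=
  crux_iff.2 fun m => (lt_or_ge m M₀).elim (hS m) (hL m)

/-- **CruxMono** (monotonicity in the number of nomes): `CruxAt (m+1) → CruxAt m`.  PROVED ON PAPER
(census §R D-6: append an algebraic logarithm `−√p` chosen among `2m+1` candidates; Tate position of
the extended tuple needs only `π ∉ ℚ̄`; the appended block costs at most its share `4`).  Typed here as a
`Prop`; its Lean proof is an M-sized support lemma, not attempted in this sketch. -/
def CruxMono : Prop := ∀ m, CruxAt (m + 1) → CruxAt m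

/-- Iterating monotonicity downward. -/
theorem cruxAt_of_add (hmono : CruxMono) : ∀ d m, CruxAt (m + d) → CruxAt m
  | 0, _, h => h
  | d + 1, m, h => cruxAt_of_add hmono d m (hmono (m + d) h)

/-- (c) FAILS for D-6 given monotonicity: the tail piece ALONE gives the crux. -/
theorem crux_of_cruxLarge_of_mono (hmono : CruxMono) (M₀ : ℕ) (hL : CruxLarge M₀) : TateLocusGPC := by
  refine crux_iff.2 fun m => ?_
  rcases lt_or_ge m M₀ with hm | hm
  · have hM : CruxAt (m + (M₀ - m)) := by
      have : m + (M₀ - m) = M₀ := by omega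
      rw [this]; exact hL M₀ le_rfl
    exact cruxAt_of_add hmono (M₀ - m) m hM
  · exact hL m hm

/-! ## D-15  slicing the conclusion -/

/-- **CruxWeak**: the crux with one unit of slack, `4m − 1 ≤ trdeg Env`. OPEN (still ≥ two nomes jointly). -/
def CruxWeak : Prop :=
  ∀ (m : ℕ) (w : Fin m → ℂ), TatePosition m w → ((4 * m - 1 : ℕ) : Cardinal) ≤ Algebra.trdeg ℚ ↥(Env m w)

/-- **NoLevel**: no Tate tuple has envelope of transcendence degree exactly `4m − 1`. OPEN, method-less. -/
def NoLevel : Prop :=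
  ∀ (m : ℕ) (w : Fin m → ℂ), TatePosition m w → Algebra.trdeg ℚ ↥(Env m w) ≠ ((4 * m - 1 : ℕ) : Cardinal)

/-- (b) for D-15: `4m − 1 ≤ t ∧ t ≠ 4m − 1 ⇒ 4m ≤ t` in `Cardinal`. -/
theorem d15_assembly (h1 : CruxWeak) (h2 : NoLevel) : TateLocusGPC := by
  refine crux_iff.2 fun m w hw => ?_
  rcases Nat.eq_zero_or_pos m with rfl | hm
  · simp
  · have hlt : ((4 * m - 1 : ℕ) : Cardinal) < Algebra.trdeg ℚ ↥(Env m w) :=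
      lt_of_le_of_ne (h1 m w hw) (Ne.symm (h2 m w hw))
    have hsucc := Order.succ_le_of_lt hlt
    rw [Cardinal.succ_natCast] at hsucc
    have h4 : ((4 * m : ℕ) : Cardinal) = ((4 * m - 1 : ℕ) : Cardinal) + 1 := by
      rw [← Nat.cast_succ]
      congr 1
      omega
    rw [h4]
    exact hsucc

/-! ## D-13′  base `m ≤ 3` ∧ induction steps -/

/-- **Steps**: the induction step in the number of nomes, from `m ≥ 3` on (for `m ≤ 2` the crux is vacuous, so a step
from `m = 2` would BE `CruxAt 3`). OPEN, mechanism-less (census §R D-13′). -/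
def Steps : Prop := ∀ m, 3 ≤ m → CruxAt m → CruxAt (m + 1)

/-- (b) for D-13′: induction on `m`. -/
theorem d13'_assembly (h1 : ∀ m, m ≤ 3 → CruxAt m) (h2 : Steps) : TateLocusGPC := by
  refine crux_iff.2 fun m => ?_
  induction m with
  | zero => exact h1 0 (by norm_num)
  | succ n ih =>
    by_cases hn : n + 1 ≤ 3
    · exact h1 _ hn
    · exact h2 n (by omega) ih

/-! ## Lemma A, bookkeeping half kernel-checked: `CruxMono` from the existence of Tate completions -/

/-- **TateCompletion** (hygiene-type existence, census §R.1: `β = −√p` for a suitable prime among `2m+1`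
candidates; uses only `π ∉ ℚ̄`): every Tate tuple extends by ONE ALGEBRAIC logarithm to a Tate tuple. -/
def TateCompletion : Prop :=
  ∀ (m : ℕ) (w : Fin m → ℂ), TatePosition m w →
    ∃ β : ℂ, IsAlgebraic ℚ β ∧ TatePosition (m + 1) (Fin.snoc w β : Fin (m + 1) → ℂ)

open IntermediateField in
open Literature.Barriers.Schanuel (trdeg_mono trdeg_adjoin_union_eq_of_isAlgebraic) in
open Literature.NumberTheory.Transcendental (trdeg_adjoin_union_le trdeg_adjoin_le_mk) in
/-- Appending an algebraic logarithm `β` raises the envelope's transcendence degree by at most `4`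
(`β` is free; `e^β, P, Q, R(e^β)` cost at most one each). -/
theorem trdeg_env_snoc_le (m : ℕ) (w : Fin m → ℂ) (β : ℂ) (hβ : IsAlgebraic ℚ β) :
    Algebra.trdeg ℚ ↥(Env (m + 1) (Fin.snoc w β : Fin (m + 1) → ℂ)) ≤ Algebra.trdeg ℚ ↥(Env m w) + 4 := by
  classical
  -- the four possibly-transcendental new generators
  set t : Fin 4 → ℂ := ![Complex.exp β, ramP (Complex.exp β), ramQ (Complex.exp β), ramR (Complex.exp β)]
    with ht
  set G : Set ℂ := Set.range w ∪ Set.range (Complex.exp ∘ w) ∪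
    Set.range (fun j => ramP (Complex.exp (w j))) ∪ Set.range (fun j => ramQ (Complex.exp (w j))) ∪
    Set.range (fun j => ramR (Complex.exp (w j))) with hG
  set w' : Fin (m + 1) → ℂ := Fin.snoc w β with hw'
  have hsub : Set.range w' ∪ Set.range (Complex.exp ∘ w') ∪
      Set.range (fun j => ramP (Complex.exp (w' j))) ∪ Set.range (fun j => ramQ (Complex.exp (w' j))) ∪
      Set.range (fun j => ramR (Complex.exp (w' j))) ⊆ (G ∪ Set.range t) ∪ {x : ℂ | IsAlgebraic ℚ x} := by
    have key : ∀ i : Fin (m + 1), (∃ j : Fin m, w' i = w j) ∨ w' i = β := by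
      intro i
      refine Fin.lastCases ?_ (fun j => ?_) i
      · right; simp [hw']
      · left; exact ⟨j, by simp [hw']⟩
    rintro x ((((⟨i, rfl⟩ | ⟨i, rfl⟩) | ⟨i, rfl⟩) | ⟨i, rfl⟩) | ⟨i, rfl⟩)
    · rcases key i with ⟨j, hj⟩ | hj
      · left; left; rw [hj]; simp [hG]
      · right; rw [hj]; exact hβ
    · rcases key i with ⟨j, hj⟩ | hj
      · left; left; simp only [Function.comp, hj]; simp [hG]
      · left; right; simp only [Function.comp, hj]; exact ⟨0, by simp [ht]⟩
    · rcases key i with ⟨j, hj⟩ | hj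
      · left; left; simp only [hj]; simp [hG]
      · left; right; simp only [hj]; exact ⟨1, by simp [ht]⟩
    · rcases key i with ⟨j, hj⟩ | hj
      · left; left; simp only [hj]; simp [hG]
      · left; right; simp only [hj]; exact ⟨2, by simp [ht]⟩
    · rcases key i with ⟨j, hj⟩ | hj
      · left; left; simp only [hj]; simp [hG]
      · left; right; simp only [hj]; exact ⟨3, by simp [ht]⟩
  have ht_le : Algebra.trdeg ℚ ↥(adjoin ℚ (Set.range t)) ≤ (4 : Cardinal) :=
    (trdeg_adjoin_le_mk _).trans (Cardinal.mk_range_le.trans_eq (Cardinal.mk_fin 4))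
  calc Algebra.trdeg ℚ ↥(Env (m + 1) w')
      ≤ Algebra.trdeg ℚ ↥(adjoin ℚ ((G ∪ Set.range t) ∪ {x : ℂ | IsAlgebraic ℚ x})) :=
        trdeg_mono (adjoin.mono ℚ _ _ hsub)
    _ = Algebra.trdeg ℚ ↥(adjoin ℚ (G ∪ Set.range t)) :=
        trdeg_adjoin_union_eq_of_isAlgebraic _ _ fun _ hx => hx
    _ ≤ Algebra.trdeg ℚ ↥(adjoin ℚ G) + Algebra.trdeg ℚ ↥(adjoin ℚ (Set.range t)) :=
        trdeg_adjoin_union_le _ _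
    _ ≤ Algebra.trdeg ℚ ↥(Env m w) + 4 := add_le_add le_rfl ht_le

/-- Cardinal cancellation: `4(m+1) ≤ t + 4 ⇒ 4m ≤ t`. -/
theorem cancel4 {t : Cardinal} {m : ℕ} (h : ((4 * (m + 1) : ℕ) : Cardinal) ≤ t + 4) :
    ((4 * m : ℕ) : Cardinal) ≤ t := by
  rcases lt_or_ge t Cardinal.aleph0 with ht | ht
  · obtain ⟨n, rfl⟩ := Cardinal.lt_aleph0.1 ht
    have h' : 4 * (m + 1) ≤ n + 4 := by exact_mod_cast h
    have hnm : 4 * m ≤ n := by omega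
    exact_mod_cast hnm
  · exact (Cardinal.natCast_lt_aleph0 (n := 4 * m)).le.trans ht

/-- **Lemma A, modulo the completion**: `TateCompletion → CruxMono` (the bookkeeping is kernel-checked; the
completion is hygiene-type existence). Hence `TateCompletion → CruxLarge M₀ → TateLocusGPC` for every `M₀`,
and likewise `SectorAlgLog → TateLocusGPC` (below): the range / sector pieces are the crux padded. -/
theorem cruxMono_of_completion (H : TateCompletion) : CruxMono := by
  intro m hm1 w hw
  obtain ⟨β, hβ, hT⟩ := H m w hw
  exact cancel4 ((hm1 _ hT).trans (trdeg_env_snoc_le m w β hβ))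

/-- (c) FAILS for D-6, kernel-checked modulo `TateCompletion`. -/
theorem crux_of_cruxLarge (H : TateCompletion) (M₀ : ℕ) (hL : CruxLarge M₀) : TateLocusGPC :=
  crux_of_cruxLarge_of_mono (cruxMono_of_completion H) M₀ hL

/-- (c) FAILS for D-5's `SectorAlgLog`, kernel-checked modulo `TateCompletion`: pad by the algebraic log. -/
theorem crux_of_sectorAlgLog (H : TateCompletion) (hL : SectorAlgLog) : TateLocusGPC := by
  refine crux_iff.2 fun m w hw => ?_
  obtain ⟨β, hβ, hT⟩ := H m w hw
  have hlast : (Fin.snoc w β : Fin (m + 1) → ℂ) (Fin.last m) = β := by simp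
  have h1 := hL (m + 1) (Fin.snoc w β) hT ⟨Fin.last m, by rw [hlast]; exact hβ⟩
  exact cancel4 (h1.trans (trdeg_env_snoc_le m w β hβ))


/-! ## Lemma A, existence half kernel-checked: `TateCompletion` holds (so `CruxMono`, and the (c)-failures of D-5/D-6, are THEOREMS) -/

section completion

open Complex

/-! ### Möbius relation `ρ = g·σ`, `g ∈ GL₂⁺(ℚ)`, in the route's polynomial spelling -/

def MEq (σ ρ : ℂ) : Prop :=
  ∃ a b c d : ℚ, 0 < a * d - b * c ∧ ρ * ((c : ℂ) * σ + (d : ℂ)) = (a : ℂ) * σ + (b : ℂ)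

theorem MEq.symm {σ ρ : ℂ} (h : MEq σ ρ) : MEq ρ σ := by
  obtain ⟨a, b, c, d, hdet, h⟩ := h
  refine ⟨d, -b, -c, a, by nlinarith [hdet], ?_⟩
  push_cast
  linear_combination (-1 : ℂ) * h

theorem MEq.trans {σ ρ θ : ℂ} (h1 : MEq σ ρ) (h2 : MEq ρ θ) : MEq σ θ := by
  obtain ⟨a, b, c, d, hdet, h1⟩ := h1
  obtain ⟨a', b', c', d', hdet', h2⟩ := h2
  refine ⟨a' * a + b' * c, a' * b + b' * d, c' * a + d' * c, c' * b + d' * d, ?_, ?_⟩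
  · have : (a' * a + b' * c) * (c' * b + d' * d) - (a' * b + b' * d) * (c' * a + d' * c) =
        (a' * d' - b' * c') * (a * d - b * c) := by ring
    rw [this]; exact mul_pos hdet' hdet
  · push_cast
    linear_combination ((c : ℂ) * σ + (d : ℂ)) * h2 - (θ * (c' : ℂ) - (a' : ℂ)) * h1

/-- `π²` is transcendental (from `transcendental_pi_holds`). -/
theorem pi_sq_transcendental : Transcendental ℚ ((Real.pi : ℂ) ^ 2) := by
  have hπ : Transcendental ℚ (Real.pi : ℂ) := by
    have h := Literature.NumberTheory.Transcendental.transcendental_pi_holds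
    -- `transcendental_pi : Transcendental ℚ Real.pi` (real); transfer along `ℝ → ℂ`
    intro halg
    apply h
    exact (isAlgebraic_algebraMap_iff (Complex.ofRealHom.injective)).mp
      (by simpa using halg)
  exact hπ.pow two_pos

/-- Two purely imaginary points `i·s/2π`, `i·s′/2π` with `s, s′` algebraic reals, `s·s′ ≠ 0` and
`s′ ∉ ℚ·s`, are never `GL₂⁺(ℚ)`-related. -/
theorem not_MEq_imag {s s' : ℝ} (hs : s ≠ 0) (hs' : s' ≠ 0)
    (halg : IsAlgebraic ℚ (s : ℂ)) (halg' : IsAlgebraic ℚ (s' : ℂ))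
    (hirr : ∀ q : ℚ, s' ≠ (q : ℝ) * s) :
    ¬ MEq (I * ((s / (2 * Real.pi) : ℝ) : ℂ)) (I * ((s' / (2 * Real.pi) : ℝ) : ℂ)) := by
  rintro ⟨a, b, c, d, hdet, h⟩
  set y : ℝ := s / (2 * Real.pi) with hy
  set y' : ℝ := s' / (2 * Real.pi) with hy'
  have hπ : Real.pi ≠ 0 := Real.pi_ne_zero
  have hy0 : y ≠ 0 := div_ne_zero hs (by positivity)
  have hy0' : y' ≠ 0 := div_ne_zero hs' (by positivity)
  have hre := congrArg Complex.re h
  have him := congrArg Complex.im h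
  simp only [mul_re, mul_im, add_re, add_im, I_re, I_im, ofReal_re, ofReal_im,
    ratCast_re, ratCast_im] at hre him
  ring_nf at hre him
  -- him : d * y' = a * y ;  hre : -(c * y * y') = b   (up to ring normal form)
  have had : a = 0 ∧ d = 0 := by
    by_cases hd : d = 0
    · subst hd
      have him' : y * (a : ℝ) = 0 := by
        have := him
        push_cast at this
        linarith
      rcases mul_eq_zero.1 him' with hy | ha
      · exact absurd hy hy0
      · exact ⟨by exact_mod_cast ha, rfl⟩
    · exfalso
      -- y' = (a/d) y ⇒ s' = (a/d) s
      have hq : y' = ((a / d : ℚ) : ℝ) * y := by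
        have hd' : (d : ℝ) ≠ 0 := by exact_mod_cast hd
        push_cast
        field_simp
        nlinarith [him]
      apply hirr (a / d)
      have : s' = ((a / d : ℚ) : ℝ) * s := by
        have h2 : y' * (2 * Real.pi) = s' := by rw [hy']; field_simp
        have h3 : y * (2 * Real.pi) = s := by rw [hy]; field_simp
        rw [← h2, ← h3, hq]; ring
      exact this
  obtain ⟨rfl, rfl⟩ := had
  have hbc : 0 < -(b * c) := by simpa using hdet
  have hb : b ≠ 0 := by rintro rfl; simp at hbc
  have hc : c ≠ 0 := by rintro rfl; simp at hbc
  -- hre : -(c * y * y') = b  ⇒  π² = -c s s' / (4 b)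
  have hpi : (Real.pi : ℝ) ^ 2 = -((c : ℝ) * s * s') / (4 * b) := by
    have hb' : (b : ℝ) ≠ 0 := by exact_mod_cast hb
    rw [hy, hy'] at hre
    field_simp at hre
    field_simp
    nlinarith [hre]
  -- hence π² is algebraic: contradiction
  apply pi_sq_transcendental
  have halgπ : IsAlgebraic ℚ (((Real.pi : ℝ) ^ 2 : ℝ) : ℂ) := by
    rw [hpi]
    push_cast
    have h1 : IsAlgebraic ℚ ((s : ℂ) * (s' : ℂ)) := halg.mul halg'
    have h2 : IsAlgebraic ℚ (-((c : ℂ) * (s : ℂ) * (s' : ℂ)) / (4 * (b : ℂ))) := by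
      have : -((c : ℂ) * (s : ℂ) * (s' : ℂ)) / (4 * (b : ℂ)) = ((-c / (4 * b) : ℚ) : ℂ) * ((s : ℂ) * (s' : ℂ)) := by
        push_cast; ring
      rw [this]
      exact (isAlgebraic_algebraMap (-c / (4 * b) : ℚ)).mul h1
    exact h2
  simpa using halgπ

/-- `i·s/2π` (`s ≠ 0` algebraic real) is not a root of a rational quadratic. -/
theorem nonQuadratic_imag {s : ℝ} (hs : s ≠ 0) (halg : IsAlgebraic ℚ (s : ℂ)) (b c : ℚ) :
    (I * ((s / (2 * Real.pi) : ℝ) : ℂ)) ^ 2 + (b : ℂ) * (I * ((s / (2 * Real.pi) : ℝ) : ℂ)) + (c : ℂ) ≠ 0 := by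
  intro h
  set y : ℝ := s / (2 * Real.pi) with hy
  have hπ : Real.pi ≠ 0 := Real.pi_ne_zero
  have hy0 : y ≠ 0 := div_ne_zero hs (by positivity)
  have hre := congrArg Complex.re h
  have him := congrArg Complex.im h
  simp only [sq, mul_re, mul_im, add_re, add_im, I_re, I_im, ofReal_re, ofReal_im,
    ratCast_re, ratCast_im, zero_re, zero_im] at hre him
  ring_nf at hre him
  -- hre : -(y*y) + c = 0 ; him : b * y = 0
  have hc : (c : ℝ) = y ^ 2 := by nlinarith [hre]
  have hc0 : c ≠ 0 := by
    rintro rfl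
    have : y ^ 2 = 0 := by exact_mod_cast hc.symm
    exact hy0 (pow_eq_zero_iff (n := 2) (by norm_num) |>.1 this)
  have hpi : (Real.pi : ℝ) ^ 2 = s ^ 2 / (4 * c) := by
    have hc' : (c : ℝ) ≠ 0 := by exact_mod_cast hc0
    rw [hy] at hc
    field_simp at hc
    field_simp
    nlinarith [hc]
  apply pi_sq_transcendental
  have halgπ : IsAlgebraic ℚ (((Real.pi : ℝ) ^ 2 : ℝ) : ℂ) := by
    rw [hpi]
    push_cast
    have h1 : IsAlgebraic ℚ ((s : ℂ) ^ 2) := halg.pow 2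
    have : (s : ℂ) ^ 2 / (4 * (c : ℂ)) = ((1 / (4 * c) : ℚ) : ℂ) * (s : ℂ) ^ 2 := by
      push_cast; ring
    rw [this]
    exact (isAlgebraic_algebraMap (1 / (4 * c) : ℚ)).mul h1
  simpa using halgπ

/-- `2` is not a `p`-th power in `ℚ` for `p ≥ 2` (2-adic valuation). -/
theorem two_not_pow {p : ℕ} (hp : 2 ≤ p) : ∀ b : ℚ, b ^ p ≠ 2 := by
  intro b hb
  have h := congrArg (padicValRat 2) hb
  rw [padicValRat.pow b] at h
  have h2 : padicValRat 2 (2 : ℚ) = 1 := by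
    have := padicValRat.self (p := 2) (by norm_num)
    simpa using this
  rw [h2] at h
  -- h : p * v = 1 in ℤ with p ≥ 2
  have hdvd : (p : ℤ) ∣ 1 := ⟨_, h.symm⟩
  have := Int.eq_one_of_dvd_one (by positivity) hdvd
  omega

/-- A family of `2m+1` positive real algebraic numbers, `ℚ`-linearly independent in `ℂ`, with pairwise
irrational ratios: the powers `α, α², …, α^{2m+1}` of `α = 2^{1/p}`, `p` prime, `p ≥ 2m+2`. -/
theorem exists_candidates (m : ℕ) :
    ∃ s : Fin (2 * m + 1) → ℝ, (∀ k, 0 < s k) ∧ (∀ k, IsAlgebraic ℚ (s k : ℂ)) ∧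
      LinearIndependent ℚ (fun k => (s k : ℂ)) ∧ (∀ k k', k ≠ k' → ∀ q : ℚ, s k' ≠ (q : ℝ) * s k) := by
  obtain ⟨p, hp, hprime⟩ := Nat.exists_infinite_primes (2 * m + 2)
  have hp2 : 2 ≤ p := hprime.two_le
  have hp0 : p ≠ 0 := by omega
  set αr : ℝ := (2 : ℝ) ^ ((p : ℝ)⁻¹) with hαr
  have hαpos : 0 < αr := Real.rpow_pos_of_pos (by norm_num) _
  have hαpow : αr ^ p = 2 := by
    rw [hαr]
    exact Real.rpow_inv_natCast_pow (by norm_num) hp0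
  set α : ℂ := (αr : ℂ) with hα
  have hαpowC : α ^ p = 2 := by rw [hα]; exact_mod_cast hαpow
  have hα0 : α ≠ 0 := by rw [hα]; exact_mod_cast hαpos.ne'
  -- minimal polynomial
  have hirr : Irreducible (Polynomial.X ^ p - Polynomial.C (2 : ℚ)) :=
    X_pow_sub_C_irreducible_of_prime hprime (two_not_pow hp2)
  have hmonic : (Polynomial.X ^ p - Polynomial.C (2 : ℚ)).Monic :=
    Polynomial.monic_X_pow_sub_C _ hp0
  have haeval : Polynomial.aeval α (Polynomial.X ^ p - Polynomial.C (2 : ℚ)) = 0 := by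
    simp [hαpowC]
  have hmin : Polynomial.X ^ p - Polynomial.C (2 : ℚ) = minpoly ℚ α :=
    minpoly.eq_of_irreducible_of_monic hirr haeval hmonic
  have hdeg : (minpoly ℚ α).natDegree = p := by
    rw [← hmin, Polynomial.natDegree_X_pow_sub_C]
  have halgα : IsAlgebraic ℚ α := ⟨_, hmonic.ne_zero, haeval⟩
  have hli := linearIndependent_pow (K := ℚ) α
  -- no power `α^j`, `0 < j < p`, is rational
  have pow_not_rat : ∀ j : ℕ, 0 < j → j < p → ∀ r : ℚ, α ^ j ≠ (r : ℂ) := by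
    intro j hj0 hjp r h
    have hP0 : (Polynomial.X ^ j - Polynomial.C r : Polynomial ℚ) ≠ 0 :=
      (Polynomial.monic_X_pow_sub_C r (by omega)).ne_zero
    have hPa : Polynomial.aeval α (Polynomial.X ^ j - Polynomial.C r) = 0 := by simp [h]
    have hle := minpoly.degree_le_of_ne_zero ℚ α hP0 hPa
    rw [← hmin, Polynomial.degree_X_pow_sub_C (by omega), Polynomial.degree_X_pow_sub_C hj0] at hle
    have : p ≤ j := by exact_mod_cast hle
    omega
  -- candidates
  refine ⟨fun k => αr ^ ((k : ℕ) + 1), fun k => pow_pos hαpos _, fun k => ?_, ?_, ?_⟩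
  · push_cast; rw [← hα]; exact halgα.pow _
  · -- sub-family of the power basis
    let f : Fin (2 * m + 1) → Fin (minpoly ℚ α).natDegree :=
      fun k => ⟨(k : ℕ) + 1, by rw [hdeg]; omega⟩
    have hf : Function.Injective f := by
      intro k k' h
      have := congrArg (fun x : Fin _ => (x : ℕ)) h
      simp only [f] at this
      exact Fin.ext (by omega)
    have h2 := hli.comp f hf
    have e : (fun k : Fin (2 * m + 1) => (((αr ^ ((k : ℕ) + 1) : ℝ)) : ℂ)) = (fun i : Fin (minpoly ℚ α).natDegree => α ^ (i : ℕ)) ∘ f := by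
      funext k; simp [f, hα]
    show LinearIndependent ℚ (fun k : Fin (2 * m + 1) => (((αr ^ ((k : ℕ) + 1) : ℝ)) : ℂ))
    rw [e]; exact h2
  · intro k k' hkk' q hq
    simp only at hq
    have hqC : α ^ ((k' : ℕ) + 1) = (q : ℂ) * α ^ ((k : ℕ) + 1) := by rw [hα]; exact_mod_cast hq
    have hne : (k : ℕ) ≠ (k' : ℕ) := fun h => hkk' (Fin.ext h)
    rcases Nat.lt_or_gt_of_ne hne with hlt | hgt
    · -- k < k' : α^(k'-k) = q
      apply pow_not_rat ((k' : ℕ) - k) (by omega) (by omega) q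
      have hsplit : α ^ ((k' : ℕ) + 1) = α ^ ((k : ℕ) + 1) * α ^ ((k' : ℕ) - k) := by
        rw [← pow_add]; congr 1; omega
      have h3 : α ^ ((k : ℕ) + 1) * α ^ ((k' : ℕ) - k) = α ^ ((k : ℕ) + 1) * (q : ℂ) := by
        rw [← hsplit, hqC]; ring
      exact mul_left_cancel₀ (pow_ne_zero _ hα0) h3
    · -- k' < k : α^(k-k') = q⁻¹
      have hsplit : α ^ ((k : ℕ) + 1) = α ^ ((k' : ℕ) + 1) * α ^ ((k : ℕ) - k') := by
        rw [← pow_add]; congr 1; omega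
      have h3 : α ^ ((k' : ℕ) + 1) * 1 = α ^ ((k' : ℕ) + 1) * ((q : ℂ) * α ^ ((k : ℕ) - k')) := by
        rw [mul_one]
        linear_combination hqC + (q : ℂ) * hsplit
      have h4 : (1 : ℂ) = (q : ℂ) * α ^ ((k : ℕ) - k') := mul_left_cancel₀ (pow_ne_zero _ hα0) h3
      have hq0 : (q : ℂ) ≠ 0 := by
        intro h0; rw [h0, zero_mul] at h4; exact one_ne_zero h4
      apply pow_not_rat ((k : ℕ) - k') (by omega) (by omega) q⁻¹
      rw [Rat.cast_inv]
      exact eq_inv_of_mul_eq_one_left (by linear_combination (-1 : ℂ) * h4)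

/-- `τ(−s) = i·s/2π` for real `s`. -/
theorem tauOf_neg_ofReal (s : ℝ) : tauOf (-(s : ℂ)) = I * ((s / (2 * Real.pi) : ℝ) : ℂ) := by
  unfold tauOf
  have hπ : (Real.pi : ℂ) ≠ 0 := by exact_mod_cast Real.pi_ne_zero
  have h2π : (2 * (Real.pi : ℂ)) ≠ 0 := by simp [hπ]
  have h0 : (2 * (Real.pi : ℂ) * I) ≠ 0 := by simp [hπ, I_ne_zero]
  rw [div_eq_iff h0]
  push_cast
  have : I * ((s : ℂ) / (2 * (Real.pi : ℂ))) * (2 * (Real.pi : ℂ) * I) =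
      (I * I) * (s : ℂ) * ((2 * (Real.pi : ℂ)) / (2 * (Real.pi : ℂ))) := by ring
  rw [this, I_mul_I, div_self h2π]
  ring

/-- **TateCompletion** (census §R.1, Lemma A existence half): every tuple in Tate position extends by one
ALGEBRAIC logarithm (`−α^{k+1}`, `α = 2^{1/p}`) to a tuple in Tate position. Uses only `π ∉ ℚ̄`. -/
theorem tateCompletion (m : ℕ) (w : Fin m → ℂ) (hw : TatePosition m w) :
    ∃ β : ℂ, IsAlgebraic ℚ β ∧ TatePosition (m + 1) (Fin.snoc w β : Fin (m + 1) → ℂ) := by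
  classical
  obtain ⟨hli_w, h2pi, hre, hnq, hineq⟩ := hw
  -- `m ≠ 0` (else `2πi ∈ span ∅ = 0`)
  have hm : 0 < m := by
    rcases Nat.eq_zero_or_pos m with rfl | h
    · exfalso
      have hr : Set.range w = ∅ := Set.range_eq_empty w
      rw [hr, Submodule.span_empty] at h2pi
      have hπ : (Real.pi : ℂ) ≠ 0 := by exact_mod_cast Real.pi_ne_zero
      simp [hπ, I_ne_zero] at h2pi
    · exact h
  haveI : Nonempty (Fin m) := ⟨⟨0, hm⟩⟩
  obtain ⟨s, hpos, halg, hli, hirr⟩ := exists_candidates m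
  set y : Fin (2 * m + 1) → ℝ := fun k => s k / (2 * Real.pi) with hy
  have hτ' : ∀ k, tauOf (-(s k : ℂ)) = I * ((y k : ℝ) : ℂ) := fun k => tauOf_neg_ofReal (s k)
  -- bad set 1: candidates inside the span
  set T₁ : Finset (Fin (2 * m + 1)) :=
    Finset.univ.filter (fun k => (s k : ℂ) ∈ Submodule.span ℚ (Set.range w)) with hT₁
  -- bad set 2: candidates Möbius-related to some old period ratio
  set Rel : Fin m → Fin (2 * m + 1) → Prop :=
    fun i k => MEq (tauOf (w i)) (I * ((y k : ℝ) : ℂ)) ∨ MEq (I * ((y k : ℝ) : ℂ)) (tauOf (w i)) with hRel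
  set T₂ : Finset (Fin (2 * m + 1)) := Finset.univ.filter (fun k => ∃ i, Rel i k) with hT₂
  -- |T₁| ≤ m : independent vectors inside an `m`-generated span
  have hT₁card : T₁.card ≤ m := by
    have hsub : LinearIndependent ℚ (fun k : T₁ => (s k : ℂ)) :=
      hli.comp (fun k : T₁ => (k : Fin (2 * m + 1))) Subtype.val_injective
    have hmem : ∀ k : T₁, (s k : ℂ) ∈ Submodule.span ℚ (Set.range w) :=
      fun k => (Finset.mem_filter.1 k.2).2
    let g : T₁ → Submodule.span ℚ (Set.range w) := fun k => ⟨(s k : ℂ), hmem k⟩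
    have hg : LinearIndependent ℚ g := by
      apply LinearIndependent.of_comp (Submodule.span ℚ (Set.range w)).subtype
      exact hsub
    haveI : Module.Finite ℚ (Submodule.span ℚ (Set.range w)) :=
      Module.Finite.span_of_finite ℚ (Set.finite_range w)
    have h1 := hg.fintype_card_le_finrank
    have h2 : Module.finrank ℚ (Submodule.span ℚ (Set.range w)) ≤ m := by
      have := finrank_range_le_card (R := ℚ) w
      simpa [Set.finrank] using this
    simpa using h1.trans h2
  -- |T₂| ≤ m : at most one candidate per old orbit
  have hT₂card : T₂.card ≤ m := by
    have hchoose : ∀ k ∈ T₂, ∃ i, Rel i k := fun k hk => (Finset.mem_filter.1 hk).2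
    choose! ι hι using hchoose
    have hinj : Set.InjOn ι ↑T₂ := by
      intro k hk k' hk' hkk'
      by_contra hne
      have hk1 := hι k hk
      have hk2 := hι k' hk'
      rw [← hkk'] at hk2
      have hM : MEq (I * ((y k : ℝ) : ℂ)) (I * ((y k' : ℝ) : ℂ)) := by
        rcases hk1 with h1 | h1 <;> rcases hk2 with h2 | h2
        · exact h1.symm.trans h2
        · exact h1.symm.trans h2.symm
        · exact h1.trans h2
        · exact h1.trans h2.symm
      exact not_MEq_imag (hpos k).ne' (hpos k').ne' (halg k) (halg k') (hirr k k' hne) hM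
    have := Finset.card_le_card_of_injOn ι (fun k hk => Finset.mem_univ (ι k)) hinj
    simpa using this
  -- a good candidate exists
  have hlt : (T₁ ∪ T₂).card < (Finset.univ : Finset (Fin (2 * m + 1))).card := by
    calc (T₁ ∪ T₂).card ≤ T₁.card + T₂.card := Finset.card_union_le _ _
      _ ≤ m + m := add_le_add hT₁card hT₂card
      _ < 2 * m + 1 := by omega
      _ = (Finset.univ : Finset (Fin (2 * m + 1))).card := by simp
  obtain ⟨k, -, hk⟩ := Finset.exists_mem_notMem_of_card_lt_card hlt
  rw [Finset.mem_union, not_or] at hk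
  obtain ⟨hk1, hk2⟩ := hk
  have hk1' : (s k : ℂ) ∉ Submodule.span ℚ (Set.range w) :=
    fun h => hk1 (Finset.mem_filter.2 ⟨Finset.mem_univ _, h⟩)
  have hk2' : ∀ i, ¬ Rel i k := fun i h => hk2 (Finset.mem_filter.2 ⟨Finset.mem_univ _, i, h⟩)
  -- the completion `β = −s_k`
  refine ⟨-(s k : ℂ), (halg k).neg, ?_, ?_, ?_, ?_, ?_⟩
  · -- linear independence
    rw [linearIndependent_finSnoc]
    exact ⟨hli_w, fun h => hk1' (neg_mem_iff.1 h)⟩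
  · -- `2πi` stays in the span
    refine Submodule.span_mono ?_ h2pi
    rintro x ⟨i, rfl⟩
    exact ⟨Fin.castSucc i, by simp⟩
  · -- real parts
    intro j
    refine Fin.lastCases ?_ (fun i => ?_) j
    · simp [hpos k]
    · simpa using hre i
  · -- non-quadratic
    intro j b c
    refine Fin.lastCases ?_ (fun i => ?_) j
    · simp only [Fin.snoc_last]
      rw [hτ' k]
      exact nonQuadratic_imag (hpos k).ne' (halg k) b c
    · simpa using hnq i b c
  · -- pairwise inequivalence
    intro i j hij a b c d hdet
    rcases Fin.eq_castSucc_or_eq_last i with ⟨i₀, rfl⟩ | rfl <;>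
      rcases Fin.eq_castSucc_or_eq_last j with ⟨j₀, rfl⟩ | rfl
    · have hij₀ : i₀ ≠ j₀ := fun h => hij (by rw [h])
      simpa using hineq i₀ j₀ hij₀ a b c d hdet
    · -- `i` old, `j` new: `¬ (τ′ = g·τ_{i₀})`
      simp only [Fin.snoc_last, Fin.snoc_castSucc]
      rw [hτ' k]
      intro h
      exact hk2' i₀ (Or.inl ⟨a, b, c, d, hdet, h⟩)
    · -- `i` new, `j` old: `¬ (τ_{j₀} = g·τ′)`
      simp only [Fin.snoc_last, Fin.snoc_castSucc]
      rw [hτ' k]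
      intro h
      exact hk2' j₀ (Or.inr ⟨a, b, c, d, hdet, h⟩)
    · exact absurd rfl hij

/-! ### A certified Tate triple: the Lindemann–Weierstrass family `(−1, −√2, 2πi − 1 − √2)` -/

/-- Translation by `1` is a `GL₂⁺(ℚ)`-relation. -/
theorem MEq_add_one (σ : ℂ) : MEq σ (σ + 1) := ⟨1, 1, 0, 1, by norm_num, by push_cast; ring⟩

theorem MEq_sub_one (σ : ℂ) : MEq (σ + 1) σ := ⟨1, -1, 0, 1, by norm_num, by push_cast; ring⟩

theorem sqrt2_irr_aux1 : ∀ q : ℚ, Real.sqrt 2 ≠ (q : ℝ) * 1 := by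
  intro q h; rw [mul_one] at h; exact irrational_sqrt_two.ne_rat q h

theorem sqrt2_irr_aux2 : ∀ q : ℚ, (1 : ℝ) ≠ (q : ℝ) * Real.sqrt 2 := by
  intro q h
  apply irrational_sqrt_two.ne_rat q⁻¹
  push_cast
  exact eq_inv_of_mul_eq_one_left (by linarith [h])

theorem sqrt2_irr_aux3 : ∀ q : ℚ, (1 + Real.sqrt 2 : ℝ) ≠ (q : ℝ) * 1 := by
  intro q h; rw [mul_one] at h
  apply irrational_sqrt_two.ne_rat (q - 1)
  push_cast; linarith

theorem sqrt2_irr_aux4 : ∀ q : ℚ, (1 : ℝ) ≠ (q : ℝ) * (1 + Real.sqrt 2) := by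
  intro q h
  have hq : q ≠ 0 := by rintro rfl; simp at h
  apply irrational_sqrt_two.ne_rat (q⁻¹ - 1)
  have hq' : (q : ℝ) ≠ 0 := by exact_mod_cast hq
  push_cast
  field_simp
  linarith

theorem sqrt2_irr_aux5 : ∀ q : ℚ, (1 + Real.sqrt 2 : ℝ) ≠ (q : ℝ) * Real.sqrt 2 := by
  intro q h
  -- 1 = (q - 1) √2
  have hq : q - 1 ≠ 0 := by
    intro h0
    have : (q : ℝ) = 1 := by exact_mod_cast (sub_eq_zero.1 h0)
    rw [this] at h; linarith
  apply irrational_sqrt_two.ne_rat (q - 1)⁻¹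
  have hq' : ((q - 1 : ℚ) : ℝ) ≠ 0 := by exact_mod_cast hq
  push_cast at hq' ⊢
  field_simp
  linarith

theorem sqrt2_irr_aux6 : ∀ q : ℚ, Real.sqrt 2 ≠ (q : ℝ) * (1 + Real.sqrt 2) := by
  intro q h
  -- √2 (1 - q) = q
  have hq : 1 - q ≠ 0 := by
    intro h0
    have : (q : ℝ) = 1 := by exact_mod_cast (sub_eq_zero.1 h0).symm
    rw [this] at h; linarith
  apply irrational_sqrt_two.ne_rat (q / (1 - q))
  have hq' : ((1 - q : ℚ) : ℝ) ≠ 0 := by exact_mod_cast hq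
  push_cast at hq' ⊢
  field_simp
  linarith

theorem isAlgebraic_sqrt2 : IsAlgebraic ℚ ((Real.sqrt 2 : ℝ) : ℂ) := by
  refine ⟨Polynomial.X ^ 2 - Polynomial.C 2, (Polynomial.monic_X_pow_sub_C (2:ℚ) two_ne_zero).ne_zero, ?_⟩
  have h : ((Real.sqrt 2 : ℝ) : ℂ) ^ 2 = 2 := by
    have := Real.sq_sqrt (show (0:ℝ) ≤ 2 by norm_num)
    exact_mod_cast this
  simp [h]

theorem isAlgebraic_one_add_sqrt2 : IsAlgebraic ℚ (((1 + Real.sqrt 2 : ℝ)) : ℂ) := by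
  have := (isAlgebraic_algebraMap (R := ℚ) (A := ℂ) (1 : ℚ)).add isAlgebraic_sqrt2
  simpa using this

/-- The Lindemann–Weierstrass Tate triple. -/
def wLW : Fin 3 → ℂ := ![-1, -((Real.sqrt 2 : ℝ) : ℂ), 2 * (Real.pi : ℂ) * I - 1 - ((Real.sqrt 2 : ℝ) : ℂ)]

theorem tauOf_wLW2 : tauOf (2 * (Real.pi : ℂ) * I - 1 - ((Real.sqrt 2 : ℝ) : ℂ)) =
    I * ((((1 + Real.sqrt 2) / (2 * Real.pi)) : ℝ) : ℂ) + 1 := by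
  have h := tauOf_neg_ofReal (1 + Real.sqrt 2)
  unfold tauOf at h ⊢
  have hπ : (Real.pi : ℂ) ≠ 0 := by exact_mod_cast Real.pi_ne_zero
  have h0 : (2 * (Real.pi : ℂ) * I) ≠ 0 := by simp [hπ, I_ne_zero]
  have : (2 * (Real.pi : ℂ) * I - 1 - ((Real.sqrt 2 : ℝ) : ℂ)) =
      (2 * (Real.pi : ℂ) * I) + (-(((1 + Real.sqrt 2 : ℝ)) : ℂ)) := by push_cast; ring
  rw [this, add_div, div_self h0, h]
  ring

/-- **The LW triple is in Tate position** (kernel-checked non-vacuity of the crux hypotheses at `m = 3`). -/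
theorem tate_wLW : TatePosition 3 wLW := by
  have hπ : Real.pi ≠ 0 := Real.pi_ne_zero
  have hs2 : (0 : ℝ) < Real.sqrt 2 := Real.sqrt_pos.2 (by norm_num)
  -- the three period ratios
  have hτ0 : tauOf (wLW 0) = I * (((1 / (2 * Real.pi)) : ℝ) : ℂ) := by
    have := tauOf_neg_ofReal 1; simpa [wLW] using this
  have hτ1 : tauOf (wLW 1) = I * (((Real.sqrt 2 / (2 * Real.pi)) : ℝ) : ℂ) := by
    have := tauOf_neg_ofReal (Real.sqrt 2); simpa [wLW] using this
  have hτ2 : tauOf (wLW 2) = I * ((((1 + Real.sqrt 2) / (2 * Real.pi)) : ℝ) : ℂ) + 1 := by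
    have := tauOf_wLW2; simpa [wLW] using this
  have halg1 : IsAlgebraic ℚ ((1 : ℝ) : ℂ) := by simpa using isAlgebraic_algebraMap (R := ℚ) (A := ℂ) (1 : ℚ)
  -- pairwise non-relation of the three imaginary parts
  have n01 := not_MEq_imag (s := 1) (s' := Real.sqrt 2) one_ne_zero hs2.ne' halg1 isAlgebraic_sqrt2 sqrt2_irr_aux1
  have n10 := not_MEq_imag (s := Real.sqrt 2) (s' := 1) hs2.ne' one_ne_zero isAlgebraic_sqrt2 halg1 sqrt2_irr_aux2
  have n02 := not_MEq_imag (s := 1) (s' := 1 + Real.sqrt 2) one_ne_zero (by positivity) halg1 isAlgebraic_one_add_sqrt2 sqrt2_irr_aux3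
  have n20 := not_MEq_imag (s := 1 + Real.sqrt 2) (s' := 1) (by positivity) one_ne_zero isAlgebraic_one_add_sqrt2 halg1 sqrt2_irr_aux4
  have n12 := not_MEq_imag (s := Real.sqrt 2) (s' := 1 + Real.sqrt 2) hs2.ne' (by positivity) isAlgebraic_sqrt2 isAlgebraic_one_add_sqrt2 sqrt2_irr_aux5
  have n21 := not_MEq_imag (s := 1 + Real.sqrt 2) (s' := Real.sqrt 2) (by positivity) hs2.ne' isAlgebraic_one_add_sqrt2 isAlgebraic_sqrt2 sqrt2_irr_aux6
  refine ⟨?_, ?_, ?_, ?_, ?_⟩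
  · -- linear independence over ℚ
    rw [Fintype.linearIndependent_iff]
    intro g hg i
    simp only [Fin.sum_univ_three, wLW, Matrix.cons_val_zero, Matrix.cons_val_one, Matrix.head_cons,
      Matrix.cons_val_two, Matrix.tail_cons, Rat.smul_def] at hg
    have hre := congrArg Complex.re hg
    have him := congrArg Complex.im hg
    simp only [add_re, add_im, mul_re, mul_im, sub_re, sub_im, neg_re, neg_im, ratCast_re, ratCast_im,
      ofReal_re, ofReal_im, I_re, I_im, one_re, one_im, zero_re, zero_im, re_ofNat, im_ofNat] at hre him
    ring_nf at hre him
    -- him : g 2 * π * 2 = 0 ; hre : -g0 - g1 √2 - g2 - g2 √2 = 0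
    have hg2 : g 2 = 0 := by
      have h' : (g 2 : ℝ) * Real.pi = 0 := by nlinarith [him]
      rcases mul_eq_zero.1 h' with h | h
      · exact_mod_cast h
      · exact absurd h hπ
    have hg2R : (g 2 : ℝ) = 0 := by exact_mod_cast hg2
    rw [hg2R] at hre
    have hg1 : g 1 = 0 := by
      by_contra h1
      apply irrational_sqrt_two.ne_rat (-(g 0) / g 1)
      have h1R : (g 1 : ℝ) ≠ 0 := by exact_mod_cast h1
      push_cast
      rw [eq_div_iff h1R]
      nlinarith [hre]
    have hg1R : (g 1 : ℝ) = 0 := by exact_mod_cast hg1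
    rw [hg1R] at hre
    have hg0 : g 0 = 0 := by
      have : (g 0 : ℝ) = 0 := by nlinarith [hre]
      exact_mod_cast this
    fin_cases i
    · exact hg0
    · exact hg1
    · exact hg2
  · -- 2πi = w₂ − w₀ − w₁
    have h : (2 * (Real.pi : ℂ) * I) = wLW 2 - wLW 0 - wLW 1 := by simp [wLW]; ring
    rw [h]
    refine Submodule.sub_mem _ (Submodule.sub_mem _ ?_ ?_) ?_
    all_goals exact Submodule.subset_span ⟨_, rfl⟩
  · -- real parts
    intro j
    fin_cases j <;> simp [wLW] <;> nlinarith [hs2]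
  · -- non-quadratic
    intro j b c
    fin_cases j
    · simp only [Fin.zero_eta]; rw [hτ0]
      exact nonQuadratic_imag (s := 1) one_ne_zero halg1 b c
    · simp only [Fin.mk_one]; rw [hτ1]
      exact nonQuadratic_imag hs2.ne' isAlgebraic_sqrt2 b c
    · simp only [Fin.reduceFinMk]; rw [hτ2]
      intro h
      apply nonQuadratic_imag (s := 1 + Real.sqrt 2) (by positivity) isAlgebraic_one_add_sqrt2 (b + 2) (1 + b + c)
      push_cast at h ⊢
      linear_combination h
  · -- pairwise inequivalence
    intro i j hij a b c d hdet h
    have hM : MEq (tauOf (wLW i)) (tauOf (wLW j)) := ⟨a, b, c, d, hdet, h⟩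
    fin_cases i <;> fin_cases j
    · exact hij rfl
    · rw [Fin.zero_eta, Fin.mk_one, hτ0, hτ1] at hM; exact n01 hM
    · rw [Fin.zero_eta, hτ0] at hM; simp only [Fin.reduceFinMk] at hM; rw [hτ2] at hM
      exact n02 (hM.trans (MEq_sub_one _))
    · rw [Fin.zero_eta, Fin.mk_one, hτ0, hτ1] at hM; exact n10 hM
    · exact hij rfl
    · rw [Fin.mk_one, hτ1] at hM; simp only [Fin.reduceFinMk] at hM; rw [hτ2] at hM
      exact n12 (hM.trans (MEq_sub_one _))
    · rw [Fin.zero_eta, hτ0] at hM; simp only [Fin.reduceFinMk] at hM; rw [hτ2] at hM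
      exact n20 ((MEq_add_one _).trans hM)
    · rw [Fin.mk_one, hτ1] at hM; simp only [Fin.reduceFinMk] at hM; rw [hτ2] at hM
      exact n21 ((MEq_add_one _).trans hM)
    · exact hij rfl

/-! ### The additive reading of the route's two-layer plan is FALSE: `¬ TauPiAdjunctionFixed` (census §R.2, D-3′) -/

open IntermediateField in
open Literature.Barriers.Schanuel (trdeg_mono trdeg_adjoin_union_eq_of_isAlgebraic) in
open Literature.NumberTheory.Transcendental (trdeg_adjoin_union_le trdeg_adjoin_le_mk) in
/-- On the LW triple the logarithms add at most ONE transcendence degree to the modular–exponential field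
(`w₀ = −1`, `w₁ = −√2` are algebraic; only `w₂ = 2πi − 1 − √2` may count). -/
theorem trdeg_env_wLW_le :
    Algebra.trdeg ℚ ↥(Env 3 wLW) ≤ Algebra.trdeg ℚ ↥(EnvMod 3 wLW) + 1 := by
  classical
  set G : Set ℂ := Set.range (Complex.exp ∘ wLW) ∪
    Set.range (fun j => ramP (Complex.exp (wLW j))) ∪ Set.range (fun j => ramQ (Complex.exp (wLW j))) ∪
    Set.range (fun j => ramR (Complex.exp (wLW j))) with hG
  have hsub : Set.range wLW ∪ Set.range (Complex.exp ∘ wLW) ∪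
      Set.range (fun j => ramP (Complex.exp (wLW j))) ∪ Set.range (fun j => ramQ (Complex.exp (wLW j))) ∪
      Set.range (fun j => ramR (Complex.exp (wLW j))) ⊆ (G ∪ {wLW 2}) ∪ {x : ℂ | IsAlgebraic ℚ x} := by
    rintro x ((((⟨i, rfl⟩ | he) | hP) | hQ) | hR)
    · fin_cases i
      · right
        show IsAlgebraic ℚ (wLW 0)
        have : wLW 0 = ((-1 : ℚ) : ℂ) := by simp [wLW]
        rw [this]; exact isAlgebraic_algebraMap _
      · right
        show IsAlgebraic ℚ (wLW 1)
        have : wLW 1 = -((Real.sqrt 2 : ℝ) : ℂ) := by simp [wLW]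
        rw [this]; exact isAlgebraic_sqrt2.neg
      · left; right; rfl
    · left; left; simp only [hG]; exact Or.inl (Or.inl (Or.inl he))
    · left; left; simp only [hG]; exact Or.inl (Or.inl (Or.inr hP))
    · left; left; simp only [hG]; exact Or.inl (Or.inr hQ)
    · left; left; simp only [hG]; exact Or.inr hR
  have h1 : Algebra.trdeg ℚ ↥(adjoin ℚ ({wLW 2} : Set ℂ)) ≤ (1 : Cardinal) :=
    (trdeg_adjoin_le_mk _).trans (by simp)
  calc Algebra.trdeg ℚ ↥(Env 3 wLW)
      ≤ Algebra.trdeg ℚ ↥(adjoin ℚ ((G ∪ {wLW 2}) ∪ {x : ℂ | IsAlgebraic ℚ x})) :=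
        trdeg_mono (adjoin.mono ℚ _ _ hsub)
    _ = Algebra.trdeg ℚ ↥(adjoin ℚ (G ∪ {wLW 2})) :=
        trdeg_adjoin_union_eq_of_isAlgebraic _ _ fun _ hx => hx
    _ ≤ Algebra.trdeg ℚ ↥(adjoin ℚ G) + Algebra.trdeg ℚ ↥(adjoin ℚ ({wLW 2} : Set ℂ)) :=
        trdeg_adjoin_union_le _ _
    _ ≤ Algebra.trdeg ℚ ↥(EnvMod 3 wLW) + 1 := add_le_add le_rfl h1

open IntermediateField in
open Literature.NumberTheory.Transcendental (trdeg_adjoin_le_mk) in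
/-- The modular–exponential field of the LW triple is finitely generated, so its transcendence degree is finite. -/
theorem trdeg_envMod_wLW_lt_aleph0 : Algebra.trdeg ℚ ↥(EnvMod 3 wLW) < Cardinal.aleph0 := by
  refine (trdeg_adjoin_le_mk _).trans_lt (Set.Finite.lt_aleph0 ?_)
  exact (((Set.finite_range _).union (Set.finite_range _)).union (Set.finite_range _)).union (Set.finite_range _)

/-- **`TauPiAdjunctionFixed` is FALSE** (kernel-checked): on the certified Tate triple `(−1, −√2, 2πi − 1 − √2)` the
logarithms add at most `1 < 3 = m` to `ℚ(e^w, P, Q, R)`. So the route's two-layer plan "MNN → TauPiAdjunction" can only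
be read in bridge form (D-11), never additively (D-3′). -/
theorem not_tauPiAdjunctionFixed : ¬ TauPiAdjunctionFixed := by
  intro H
  have h := (H 3 wLW tate_wLW).trans trdeg_env_wLW_le
  obtain ⟨n, hn⟩ := Cardinal.lt_aleph0.1 trdeg_envMod_wLW_lt_aleph0
  rw [hn] at h
  have h' : n + 3 ≤ n + 1 := by exact_mod_cast h
  omega

/-- … and the certified triple shows the crux's hypotheses are satisfiable at `m = 3` (non-vacuity, kernel-checked). -/
theorem tatePosition_satisfiable_three : ∃ w : Fin 3 → ℂ, TatePosition 3 w := ⟨wLW, tate_wLW⟩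

end completion

/-- **TateCompletion holds** (only `π ∉ ℚ̄` used: `transcendental_pi_holds`). -/
theorem tateCompletion_holds : TateCompletion := tateCompletion

/-- **Lemma A** (census §R.1): the crux is monotone decreasing in the number of nomes. -/
theorem cruxMono : CruxMono := cruxMono_of_completion tateCompletion_holds

/-- (c) FAILS for D-6, unconditionally: the tail piece alone is the crux. -/
theorem cruxLarge_iff (M₀ : ℕ) : CruxLarge M₀ ↔ TateLocusGPC :=
  ⟨crux_of_cruxLarge tateCompletion_holds M₀, fun h m _ => crux_iff.1 h m⟩

/-- (c) FAILS for D-5, unconditionally: the "some algebraic logarithm" sector piece alone is the crux. -/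
theorem sectorAlgLog_iff : SectorAlgLog ↔ TateLocusGPC :=
  ⟨crux_of_sectorAlgLog tateCompletion_holds, fun h m w hw _ => crux_iff.1 h m w hw⟩

end Summit.Schanuel.Schanuel.Cruxes.TateLocusGPC.StrategistR1
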